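import Summits.ValiantsHypothesis.ValiantsHypothesis.Theorems.LacunarySymmetroidMatrixDescartesOverlapWindow

/-!
# `MatrixDescartes` — the OVERLAP WINDOW LAW in relative currency (letter norms, conditioning, weight ratio)

HONEST FRAMING.  Object-search cell `pub-symmetroid`, crux `Theses.LacunarySymmetroid.MatrixDescartes` (ledger item
`stmt-ValiantsHypothesis-18050`, route `LacunarySymmetroid`; seat `val-sym-mdr-p2`, gen 13).  The crux implies `VP ≠ VNP`
by the route's assembly; NOTHING here is progress on it, and nothing here is a claim about `VP ≠ VNP`, `DoorA26` /
`DoorA34` or the cell's registers.  Sequel of `…OverlapWindow` (the exact overlap window law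
`Overlap.card_roots_Icc_le_of_liveSet`): the same law in the cell's RELATIVE CURRENCY (`card_roots_Icc_le_of_liveSet_rel`).
Data: entry bounds `|S l i j| ≤ σ l` (`σ ≥ 0`, `σ t > 0`), conditioning of the survivor letter `|det S t| ≥ η·σ_t^m`, a cut
set `A` (every live non-survivor exponent cut, `m·d t` not cut) whose weights on the non-live maps are at most `Ω` times
the survivor weight `∏_{a∈A}|m·d t − a| ≥ 1` (`one_le_prod_abs_sub`; crude bound `prod_abs_sub_le_pow`: `Ω = D^#A` if all
exponents in play are `≤ D`), and at the two endpoints of the window every live letter is `≤ M×` and every outside letter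
`≤ ε×` the survivor letter `σ_t·x^(d t)`.  THEN: if `m!·K^m·Ω·ε·M^(m−1) < η`, the window `[u, v]` carries at most `#A`
distinct zeros of `det F` (each non-live row-choice term has one factor `≤ ε` and the others `≤ M`, `prod_le_of_one_small`;
there are at most `K^m` of them; Leibniz `abs_det_rowChoice_le`).  ARBITRARY real letters; no symmetry used.
[folklore] (Laguerre's method; Leibniz bounds).
-/

-- `Summit.ValiantsHypothesis.ValiantsHypothesis.…` repeats a component by the D-0017 layout (single-conjunct summit).
set_option linter.dupNamespace false

namespace Summit.ValiantsHypothesis.ValiantsHypothesis.Theorems.LacunarySymmetroidMatrixDescartes.Overlap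

open Polynomial Finset Set
open scoped BigOperators Matrix

variable {K m : ℕ}

/-! ## §5 Weights and the relative currency -/

/-- **Survivor weight is at least one.**  For natural cuts `A` not containing the natural number `n`, `1 ≤ ∏_{a∈A} |n − a|`.
[folklore] -/
theorem one_le_prod_abs_sub (A : Finset ℕ) (n : ℕ) (hn : n ∉ A) : (1 : ℝ) ≤ ∏ a ∈ A, |(n : ℝ) - a| := by
  refine Finset.one_le_prod fun a ha => ?_
  have hne : (n : ℤ) ≠ a := fun h => hn (by rw [← Int.natCast_inj.1 h] at ha; exact ha)
  have h1 : (1 : ℤ) ≤ |(n : ℤ) - a| := Int.one_le_abs (sub_ne_zero.2 hne)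
  have h2 : ((1 : ℤ) : ℝ) ≤ ((|(n : ℤ) - a| : ℤ) : ℝ) := by exact_mod_cast h1
  simpa using h2

/-- **Crude weight bound.**  If every exponent in play is at most `D` (`a ≤ D` for `a ∈ A`, `n ≤ D`), then
`∏_{a∈A} |n − a| ≤ D^#A`. [folklore] -/
theorem prod_abs_sub_le_pow (A : Finset ℕ) (n D : ℕ) (hn : n ≤ D) (hA : ∀ a ∈ A, a ≤ D) :
    ∏ a ∈ A, |(n : ℝ) - a| ≤ (D : ℝ) ^ A.card := by
  rw [← Finset.prod_const]
  refine Finset.prod_le_prod (fun a _ => abs_nonneg _) fun a ha => ?_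
  rw [abs_sub_le_iff]
  have h1 : (n : ℝ) ≤ D := by exact_mod_cast hn
  have h2 : (a : ℝ) ≤ D := by exact_mod_cast hA a ha
  have h3 : (0 : ℝ) ≤ n := Nat.cast_nonneg n
  have h4 : (0 : ℝ) ≤ a := Nat.cast_nonneg a
  constructor <;> linarith

/-- product bookkeeping: one factor is `≤ ε·s`, all are `≤ M·s` (`0 ≤ ε`, `0 ≤ s`, factors `≥ 0`) ⇒ the product of `m`
factors is `≤ ε·M^(m−1)·s^m`. [folklore] -/
theorem prod_le_of_one_small {m : ℕ} (b : Fin m → ℝ) (hb : ∀ i, 0 ≤ b i) {ε M s : ℝ} (hε : 0 ≤ ε)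
    (hs : 0 ≤ s) (hall : ∀ i, b i ≤ M * s) (i₀ : Fin m) (hi₀ : b i₀ ≤ ε * s) :
    ∏ i, b i ≤ ε * M ^ (m - 1) * s ^ m := by
  classical
  have hsplit : ∏ i, b i = b i₀ * ∏ i ∈ Finset.univ.erase i₀, b i :=
    (Finset.mul_prod_erase Finset.univ b (Finset.mem_univ i₀)).symm
  rw [hsplit]
  have hrest : ∏ i ∈ Finset.univ.erase i₀, b i ≤ ∏ _i ∈ Finset.univ.erase i₀, M * s :=
    Finset.prod_le_prod (fun i _ => hb i) fun i _ => hall i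
  rw [Finset.prod_const, Finset.card_erase_of_mem (Finset.mem_univ i₀), Finset.card_univ, Fintype.card_fin] at hrest
  have hm : 1 ≤ m := by
    rcases Nat.eq_zero_or_pos m with h | h
    · subst h; exact (Fin.elim0 i₀)
    · exact h
  calc b i₀ * ∏ i ∈ Finset.univ.erase i₀, b i ≤ (ε * s) * (M * s) ^ (m - 1) :=
        mul_le_mul hi₀ hrest (Finset.prod_nonneg fun i _ => hb i) (mul_nonneg hε hs)
    _ = ε * M ^ (m - 1) * s ^ m := by
        rw [mul_pow]
        have : s ^ m = s * s ^ (m - 1) := by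
          rw [← pow_succ', Nat.sub_add_cancel hm]
        rw [this]; ring

/-- **OVERLAP WINDOW LAW, relative currency.**  Entry bounds `|S l i j| ≤ σ l` (`σ ≥ 0`, `σ t > 0`), conditioning of the
survivor `|det S t| ≥ η·σ_t^m`, cut set `A` (live non-survivor exponents cut, `m·d t` not cut) with weight ratio `≤ Ω`
against the survivor weight on the non-live maps, and at both endpoints `x = u, v`: every live letter is `≤ M×` and every
outside letter `≤ ε×` the survivor letter `σ_t·x^(d t)` (`0 ≤ ε ≤ M`).  If `m!·K^m·Ω·ε·M^(m−1) < η` then `det F`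
has at most `#A` distinct zeros in `[u, v]`. [folklore] -/
theorem card_roots_Icc_le_of_liveSet_rel (d : Fin K → ℕ) (S : Fin K → Matrix (Fin m) (Fin m) ℝ) (σ : Fin K → ℝ)
    (hσ : ∀ l i j, |S l i j| ≤ σ l) (hσ0 : ∀ l, 0 ≤ σ l)
    (L : Finset (Fin K)) (t : Fin K) (ht : t ∈ L) (hσt : 0 < σ t) (A : Finset ℕ) (hAt : m * d t ∉ A)
    (hA : ∀ f : Fin m → Fin K, (∀ i, f i ∈ L) → (∃ i, f i ≠ t) → (∑ i, d (f i)) ∈ A)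
    {η M ε Ω : ℝ} (hM0 : 0 ≤ M) (hε0 : 0 ≤ ε) (hεM : ε ≤ M) (hΩ0 : 0 ≤ Ω)
    (hdet : η * σ t ^ m ≤ |(S t).det|)
    (hweight : ∀ f : Fin m → Fin K, (¬ ∀ i, f i ∈ L) →
      ∏ a ∈ A, |((∑ i, d (f i) : ℕ) : ℝ) - a| ≤ Ω * ∏ a ∈ A, |((m * d t : ℕ) : ℝ) - a|)
    (hconst : (m.factorial : ℝ) * (K : ℝ) ^ m * Ω * ε * M ^ (m - 1) < η)
    {u v : ℝ} (hu : 0 < u) (huv : u ≤ v)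
    (hlive : ∀ x : ℝ, (x = u ∨ x = v) → ∀ k ∈ L, σ k * x ^ d k ≤ M * (σ t * x ^ d t))
    (hout : ∀ x : ℝ, (x = u ∨ x = v) → ∀ l ∉ L, σ l * x ^ d l ≤ ε * (σ t * x ^ d t)) :
    ((Matrix.det (∑ l, ((X : ℝ[X]) ^ d l) • (S l).map C)).roots.toFinset.filter
        (fun x => x ∈ Icc u v)).card ≤ A.card := by
  classical
  -- the certificate at an endpoint `x`
  have hcert : ∀ x : ℝ, (x = u ∨ x = v) →
      ∑ f ∈ Finset.univ.filter (fun f : Fin m → Fin K => ¬ ∀ i, f i ∈ L),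
        (∏ a ∈ A, |((∑ i, d (f i) : ℕ) : ℝ) - a|) * |Matrix.det (Matrix.of fun i j => S (f i) i j)| *
          x ^ (∑ i, d (f i))
      < (∏ a ∈ A, |((m * d t : ℕ) : ℝ) - a|) * |(S t).det| * x ^ (m * d t) := by
    intro x hxuv
    have hx : 0 < x := by rcases hxuv with rfl | rfl; exact hu; exact hu.trans_le huv
    set s : ℝ := σ t * x ^ d t with hs
    have hs0 : 0 < s := mul_pos hσt (pow_pos hx _)
    set W : ℝ := ∏ a ∈ A, |((m * d t : ℕ) : ℝ) - a| with hWdef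
    have hW1 : 1 ≤ W := one_le_prod_abs_sub A (m * d t) hAt
    have hW0 : 0 < W := zero_lt_one.trans_le hW1
    -- each non-live term is at most `Ω W · m! · ε M^(m−1) s^m`
    have hterm : ∀ f ∈ Finset.univ.filter (fun f : Fin m → Fin K => ¬ ∀ i, f i ∈ L),
        (∏ a ∈ A, |((∑ i, d (f i) : ℕ) : ℝ) - a|) * |Matrix.det (Matrix.of fun i j => S (f i) i j)| *
          x ^ (∑ i, d (f i))
        ≤ Ω * W * ((m.factorial : ℝ) * (ε * M ^ (m - 1) * s ^ m)) := by
      intro f hf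
      rw [Finset.mem_filter] at hf
      obtain ⟨i₀, hi₀⟩ : ∃ i, f i ∉ L := by
        by_contra h; push Not at h; exact hf.2 h
      have hdetf := abs_det_rowChoice_le S σ hσ f
      have hprod : (∏ i, σ (f i)) * x ^ (∑ i, d (f i)) = ∏ i, (σ (f i) * x ^ d (f i)) := by
        rw [← Finset.prod_pow_eq_pow_sum, ← Finset.prod_mul_distrib]
      have hsmall : ∏ i, (σ (f i) * x ^ d (f i)) ≤ ε * M ^ (m - 1) * s ^ m :=
        prod_le_of_one_small (fun i => σ (f i) * x ^ d (f i)) (fun i => mul_nonneg (hσ0 _) (pow_nonneg hx.le _))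
          hε0 hs0.le (fun i => by
            by_cases hiL : f i ∈ L
            · exact hlive x hxuv (f i) hiL
            · exact (hout x hxuv (f i) hiL).trans (mul_le_mul_of_nonneg_right hεM hs0.le)) i₀
          (hout x hxuv (f i₀) hi₀)
      have h1 : |Matrix.det (Matrix.of fun i j => S (f i) i j)| * x ^ (∑ i, d (f i)) ≤
          (m.factorial : ℝ) * (ε * M ^ (m - 1) * s ^ m) := by
        calc |Matrix.det (Matrix.of fun i j => S (f i) i j)| * x ^ (∑ i, d (f i))
            ≤ ((m.factorial : ℝ) * ∏ i, σ (f i)) * x ^ (∑ i, d (f i)) :=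
              mul_le_mul_of_nonneg_right hdetf (pow_nonneg hx.le _)
          _ = (m.factorial : ℝ) * ∏ i, (σ (f i) * x ^ d (f i)) := by rw [mul_assoc, hprod]
          _ ≤ (m.factorial : ℝ) * (ε * M ^ (m - 1) * s ^ m) :=
              mul_le_mul_of_nonneg_left hsmall (Nat.cast_nonneg _)
      calc (∏ a ∈ A, |((∑ i, d (f i) : ℕ) : ℝ) - a|) * |Matrix.det (Matrix.of fun i j => S (f i) i j)| *
            x ^ (∑ i, d (f i))
          = (∏ a ∈ A, |((∑ i, d (f i) : ℕ) : ℝ) - a|) *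
              (|Matrix.det (Matrix.of fun i j => S (f i) i j)| * x ^ (∑ i, d (f i))) := by ring
        _ ≤ (Ω * W) * ((m.factorial : ℝ) * (ε * M ^ (m - 1) * s ^ m)) :=
            mul_le_mul (hweight f hf.2) h1 (mul_nonneg (abs_nonneg _) (pow_nonneg hx.le _))
              (mul_nonneg hΩ0 hW0.le)
        _ = Ω * W * ((m.factorial : ℝ) * (ε * M ^ (m - 1) * s ^ m)) := by ring
    -- number of non-live maps ≤ K^m
    have hcount : ((Finset.univ.filter (fun f : Fin m → Fin K => ¬ ∀ i, f i ∈ L)).card : ℝ) ≤ (K : ℝ) ^ m := by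
      have h := Finset.card_filter_le (Finset.univ : Finset (Fin m → Fin K)) (fun f => ¬ ∀ i, f i ∈ L)
      rw [Finset.card_univ, Fintype.card_fun, Fintype.card_fin, Fintype.card_fin] at h
      exact_mod_cast h
    have hsum := Finset.sum_le_sum hterm
    rw [Finset.sum_const, nsmul_eq_mul] at hsum
    have hrhs : W * |(S t).det| * x ^ (m * d t) ≥ W * (η * s ^ m) := by
      have : η * s ^ m = η * σ t ^ m * x ^ (m * d t) := by
        rw [hs, mul_pow, ← pow_mul, mul_comm (d t) m]; ring
      rw [this, ← mul_assoc]
      exact mul_le_mul_of_nonneg_right (mul_le_mul_of_nonneg_left hdet hW0.le) (pow_nonneg hx.le _)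
    have hnonneg : 0 ≤ Ω * W * ((m.factorial : ℝ) * (ε * M ^ (m - 1) * s ^ m)) := by positivity
    calc ∑ f ∈ Finset.univ.filter (fun f : Fin m → Fin K => ¬ ∀ i, f i ∈ L),
          (∏ a ∈ A, |((∑ i, d (f i) : ℕ) : ℝ) - a|) * |Matrix.det (Matrix.of fun i j => S (f i) i j)| *
            x ^ (∑ i, d (f i))
        ≤ ((Finset.univ.filter (fun f : Fin m → Fin K => ¬ ∀ i, f i ∈ L)).card : ℝ) *
            (Ω * W * ((m.factorial : ℝ) * (ε * M ^ (m - 1) * s ^ m))) := hsum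
      _ ≤ (K : ℝ) ^ m * (Ω * W * ((m.factorial : ℝ) * (ε * M ^ (m - 1) * s ^ m))) :=
          mul_le_mul_of_nonneg_right hcount hnonneg
      _ = ((m.factorial : ℝ) * (K : ℝ) ^ m * Ω * ε * M ^ (m - 1)) * (W * s ^ m) := by ring
      _ < η * (W * s ^ m) := mul_lt_mul_of_pos_right hconst (mul_pos hW0 (pow_pos hs0 _))
      _ = W * (η * s ^ m) := by ring
      _ ≤ W * |(S t).det| * x ^ (m * d t) := hrhs
  exact card_roots_Icc_le_of_liveSet d S L t ht A hA hu huv (hcert u (Or.inl rfl)) (hcert v (Or.inr rfl))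

end Summit.ValiantsHypothesis.ValiantsHypothesis.Theorems.LacunarySymmetroidMatrixDescartes.Overlap
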